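import Mathlib
import Summits.Ventures.HodgeRepro2.Hypothesis

/-!
# T4GroupData — sub-claim B1 (the group + hermitian space + signatures): the elementary kernel facts

Kernel annex of route/T4-B1-p3.md (cell pub-hodge-repro2, owner p3). Three elementary inputs of the
B1 identification are proved here, against p2's definitions (`signatureAt`, `unitaryGroup`,
`conjTransposeK`, `ρ` of Hypothesis.lean) and Mathlib only:

* **A. The real local invariant** (Gross 2021 §3, «d ≡ (−1)^s»): for a hermitian matrix over ℂ
  with no zero eigenvalue, the determinant is the real number (−1)^{#negative eigenvalues}·∏|λ_i|.
  In particular a Gram matrix of signature (p, q) with p + q = m has determinant of sign (−1)^q —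
  negative for the Picard signature (2,1), positive for a definite form. Used in Lemmas B1.2.5 and
  B1.4.2 of the prose (the real places contribute the sign (−1)^{q_τ} to the product of local symbols).
* **B. Scaling the form** (prose B1.3): `unitaryGroup K (a • H) = unitaryGroup K H` for every scalar
  a ≠ 0 — an automorphism preserves H iff it preserves a·H; and for rank 3 the determinant is
  multiplied by a³ = a·N_{K/K⁺}(a) when ρ a = a, i.e. by a up to a norm: the two local isomorphism
  classes of rank 3 have the same unitary group.
* **C. The reciprocity bookkeeping** of Lemmas B1.2.4–B1.2.5 in an abstract model: local quadratic
  characters χ_v : G_v →* ℤˣ (the Hilbert symbols (·,θ)_v, whose kernels are the local norms —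
  O'Meara p0180), the global symbol ∏ᶠ_v χ_v(d_v), a «principal» subgroup P on which the product
  formula holds (the PRINTED input: O'Meara 71:18, Hilbert reciprocity) and the index-2 statement
  (the PRINTED input: O'Meara 65:21). Proved: an idèle with global symbol −1 is not in P·N
  (`not_mem_sup_of_symbolProd_eq_neg_one` — Liu's Def. C.3 incoherence from one non-norm
  component, `mulSingle_not_mem_sup`), and, given index 2 and one idèle of symbol −1, the converse
  (`symbolProd_eq_neg_one_iff_not_mem`): Liu's Def. C.3 ⟺ Gross §4 «odd number of non-norm
  determinants».

Nothing here is adelic in Mathlib's sense: Part C is a model whose two hypotheses are exactly the two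
printed theorems the prose cites; the prose (T4-B1-p3.md, Lemmas B1.2.4–B1.2.5) supplies the
instantiation. Axioms: standard (propext, Classical.choice, Quot.sound).
-/

namespace Summit.Ventures.HodgeRepro2.T4GroupData

open Summit.Ventures.HodgeRepro2.ShimuraData

/-! ## A. The real local invariant: sign of the determinant = (−1)^{#negative eigenvalues} -/

section DetSign

/-- A non-zero real number is (−1)^{[x < 0]} times its absolute value. -/
theorem eq_neg_one_pow_mul_abs (x : ℝ) (hx : x ≠ 0) :
    x = (if x < 0 then (-1 : ℝ) else 1) * |x| := by
  rcases lt_or_gt_of_ne hx with h | h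
  · simp [h, abs_of_neg h]
  · simp [not_lt.mpr h.le, abs_of_pos h]

/-- A product of non-zero reals is (−1)^{number of negative factors} times the product of the
absolute values. -/
theorem prod_eq_neg_one_pow_mul_prod_abs {ι : Type*} [Fintype ι] (f : ι → ℝ)
    (hf : ∀ i, f i ≠ 0) :
    ∏ i, f i = (-1 : ℝ) ^ (Finset.univ.filter (fun i => f i < 0)).card * ∏ i, |f i| := by
  calc ∏ i, f i = ∏ i, ((if f i < 0 then (-1 : ℝ) else 1) * |f i|) :=
        Finset.prod_congr rfl (fun i _ => eq_neg_one_pow_mul_abs (f i) (hf i))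
    _ = (∏ i, (if f i < 0 then (-1 : ℝ) else 1)) * ∏ i, |f i| := Finset.prod_mul_distrib
    _ = (-1 : ℝ) ^ (Finset.univ.filter (fun i => f i < 0)).card * ∏ i, |f i| := by
        rw [Finset.prod_ite, Finset.prod_const, Finset.prod_const_one, mul_one]

variable {m : ℕ}

/-- Gross 2021 §3 «d ≡ (−1)^s»: the determinant of a hermitian matrix over ℂ with no zero
eigenvalue is the real number (−1)^{#negative eigenvalues} · ∏ |λ_i|. -/
theorem det_eq_neg_one_pow_mul_prod_abs (A : Matrix (Fin m) (Fin m) ℂ) (hA : A.IsHermitian)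
    (h0 : ∀ i, hA.eigenvalues i ≠ 0) :
    A.det = (((-1 : ℝ) ^ (Finset.univ.filter (fun i => hA.eigenvalues i < 0)).card *
      ∏ i, |hA.eigenvalues i| : ℝ) : ℂ) := by
  rw [hA.det_eq_prod_eigenvalues, ← prod_eq_neg_one_pow_mul_prod_abs _ h0, Complex.ofReal_prod]
  rfl

/-- If the numbers of positive and of negative eigenvalues add up to the size, no eigenvalue
vanishes (the form is non-degenerate). -/
theorem eigenvalues_ne_zero_of_card_add_card (A : Matrix (Fin m) (Fin m) ℂ) (hA : A.IsHermitian)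
    (h : (Finset.univ.filter (fun i => 0 < hA.eigenvalues i)).card +
      (Finset.univ.filter (fun i => hA.eigenvalues i < 0)).card = m) :
    ∀ i, hA.eigenvalues i ≠ 0 := by
  intro i hi
  have hdisj : Disjoint (Finset.univ.filter (fun i => 0 < hA.eigenvalues i))
      (Finset.univ.filter (fun i => hA.eigenvalues i < 0)) := by
    rw [Finset.disjoint_filter]
    intro j _ h1 h2
    exact absurd (h1.trans h2) (lt_irrefl _)
  have hcard : ((Finset.univ.filter (fun i => 0 < hA.eigenvalues i)) ∪
      (Finset.univ.filter (fun i => hA.eigenvalues i < 0))).card = Fintype.card (Fin m) := by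
    rw [Finset.card_union_of_disjoint hdisj, h, Fintype.card_fin]
  have huniv := Finset.eq_univ_of_card _ hcard
  have hmem : i ∈ (Finset.univ.filter (fun i => 0 < hA.eigenvalues i)) ∪
      (Finset.univ.filter (fun i => hA.eigenvalues i < 0)) := by
    rw [huniv]; exact Finset.mem_univ i
  rw [Finset.mem_union, Finset.mem_filter, Finset.mem_filter] at hmem
  rcases hmem with ⟨_, h1⟩ | ⟨_, h2⟩
  · rw [hi] at h1; exact lt_irrefl _ h1
  · rw [hi] at h2; exact lt_irrefl _ h2

variable {K : Type*} [Field K]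

/-- The signature (p, q) of p2's `signatureAt` in terms of the eigenvalue counts, when the
complexified Gram matrix is hermitian. -/
theorem signatureAt_eq (τ : K →+* ℂ) (H : Matrix (Fin m) (Fin m) K) (hH : (H.map τ).IsHermitian) :
    signatureAt K τ H = ((Finset.univ.filter (fun i => 0 < hH.eigenvalues i)).card,
      (Finset.univ.filter (fun i => hH.eigenvalues i < 0)).card) := by
  unfold signatureAt
  rw [dif_pos hH]

/-- The real local invariant in p2's vocabulary: a Gram matrix of signature (p, q) with
p + q = m (non-degenerate) has determinant the real number (−1)^q · ∏ |λ_i| at that place. -/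
theorem det_map_eq_of_signatureAt (τ : K →+* ℂ) (H : Matrix (Fin m) (Fin m) K)
    (hH : (H.map τ).IsHermitian) {p q : ℕ} (hsig : signatureAt K τ H = (p, q)) (hpq : p + q = m) :
    (H.map τ).det = (((-1 : ℝ) ^ q * ∏ i, |hH.eigenvalues i| : ℝ) : ℂ) := by
  rw [signatureAt_eq τ H hH] at hsig
  obtain ⟨hp, hq⟩ := Prod.mk.inj hsig
  have h0 := eigenvalues_ne_zero_of_card_add_card (H.map τ) hH (by rw [hp, hq]; exact hpq)
  rw [det_eq_neg_one_pow_mul_prod_abs _ hH h0, hq]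

/-- The product of the absolute values of the eigenvalues of a non-degenerate hermitian matrix is
positive. -/
theorem prod_abs_eigenvalues_pos (A : Matrix (Fin m) (Fin m) ℂ) (hA : A.IsHermitian)
    (h0 : ∀ i, hA.eigenvalues i ≠ 0) : 0 < ∏ i, |hA.eigenvalues i| :=
  Finset.prod_pos (fun i _ => abs_pos.mpr (h0 i))

/-- Signature (p, q) with q odd (e.g. the Picard signature (2,1)): the determinant of the
complexified Gram matrix is a negative real number. -/
theorem det_map_re_neg_of_odd (τ : K →+* ℂ) (H : Matrix (Fin m) (Fin m) K)
    (hH : (H.map τ).IsHermitian) {p q : ℕ} (hsig : signatureAt K τ H = (p, q)) (hpq : p + q = m)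
    (hq : Odd q) : ((H.map τ).det).re < 0 ∧ ((H.map τ).det).im = 0 := by
  have h0 : ∀ i, hH.eigenvalues i ≠ 0 := by
    rw [signatureAt_eq τ H hH] at hsig
    obtain ⟨hp, hq'⟩ := Prod.mk.inj hsig
    exact eigenvalues_ne_zero_of_card_add_card (H.map τ) hH (by rw [hp, hq']; exact hpq)
  rw [det_map_eq_of_signatureAt τ H hH hsig hpq, Complex.ofReal_re, Complex.ofReal_im]
  refine ⟨?_, rfl⟩
  rw [hq.neg_one_pow]
  have := prod_abs_eigenvalues_pos (H.map τ) hH h0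
  linarith

/-- Signature (p, q) with q even (e.g. a definite form, q = 0): the determinant of the complexified
Gram matrix is a positive real number. -/
theorem det_map_re_pos_of_even (τ : K →+* ℂ) (H : Matrix (Fin m) (Fin m) K)
    (hH : (H.map τ).IsHermitian) {p q : ℕ} (hsig : signatureAt K τ H = (p, q)) (hpq : p + q = m)
    (hq : Even q) : 0 < ((H.map τ).det).re ∧ ((H.map τ).det).im = 0 := by
  have h0 : ∀ i, hH.eigenvalues i ≠ 0 := by
    rw [signatureAt_eq τ H hH] at hsig
    obtain ⟨hp, hq'⟩ := Prod.mk.inj hsig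
    exact eigenvalues_ne_zero_of_card_add_card (H.map τ) hH (by rw [hp, hq']; exact hpq)
  rw [det_map_eq_of_signatureAt τ H hH hsig hpq, Complex.ofReal_re, Complex.ofReal_im]
  refine ⟨?_, rfl⟩
  rw [hq.neg_one_pow, one_mul]
  exact prod_abs_eigenvalues_pos (H.map τ) hH h0

/-- The Picard signature (n, 1) at τ₁ (p2's `IsPicardSignature`): the determinant of the Gram
matrix at τ₁ is a negative real number — the real local invariant there is −1 (Lemma B1.4.2). -/
theorem det_map_re_neg_of_isPicardSignature {n : ℕ} (τ₁ : K →+* ℂ)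
    (H : Matrix (Fin (n + 1)) (Fin (n + 1)) K) (hH : (H.map τ₁).IsHermitian)
    (hP : IsPicardSignature K τ₁ H) : ((H.map τ₁).det).re < 0 :=
  (det_map_re_neg_of_odd τ₁ H hH hP.1 rfl odd_one).1

/-- A definite form (signature (m, 0) or (0, m)) at τ with m even, or (m, 0) for any m: the
determinant at τ is a positive real number; stated for (m, 0) — the totally positive definite case
of Liu Def. C.3. -/
theorem det_map_re_pos_of_signatureAt_eq_zero (τ : K →+* ℂ) (H : Matrix (Fin m) (Fin m) K)
    (hH : (H.map τ).IsHermitian) (hsig : signatureAt K τ H = (m, 0)) : 0 < ((H.map τ).det).re :=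
  (det_map_re_pos_of_even τ H hH hsig (Nat.add_zero m) ⟨0, by simp⟩).1

end DetSign

/-! ## B. Scaling the hermitian form does not change the unitary group (prose B1.3) -/

section Scaling

variable {K : Type*} [Field K] [NumberField K] [NumberField.IsCMField K] {m : ℕ}

/-- An automorphism preserves the form H iff it preserves a·H (a ≠ 0): the unitary groups of H and
of a·H coincide. For rank 3 and a a local non-norm, H and a·H lie in the two different local
isomorphism classes (Gross §3), so both local unitary groups are isomorphic (prose B1.3). -/
theorem unitaryGroup_smul (a : K) (ha : a ≠ 0) (H : Matrix (Fin m) (Fin m) K) :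
    unitaryGroup K (a • H) = unitaryGroup K H := by
  ext g
  show conjTransposeK K (g : Matrix (Fin m) (Fin m) K) * (a • H) * (g : Matrix (Fin m) (Fin m) K)
      = a • H ↔ conjTransposeK K (g : Matrix (Fin m) (Fin m) K) * H * (g : Matrix (Fin m) (Fin m) K)
      = H
  rw [Matrix.mul_smul, Matrix.smul_mul]
  exact (smul_right_injective (Matrix (Fin m) (Fin m) K) ha).eq_iff

/-- Scaling by a ρ-fixed scalar (an element of the maximal real subfield) preserves hermitian-ness. -/
theorem isHermitianForm_smul (a : K) (hρ : ρ K a = a) (H : Matrix (Fin m) (Fin m) K)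
    (hH : IsHermitianForm K H) : IsHermitianForm K (a • H) := by
  unfold IsHermitianForm conjTransposeK at *
  have hmap : (a • H).map (ρ K) = a • H.map (ρ K) := by
    ext i j
    simp only [Matrix.map_apply, Matrix.smul_apply, smul_eq_mul, map_mul, hρ]
  rw [hmap, Matrix.transpose_smul, hH]

/-- Rank 3: the determinant of a·H is a³·det H = (a · N_{K/K⁺}(a)) · det H for ρ a = a, i.e. det H
times a, up to the norm a·ρ(a) = a²: scaling by a non-norm switches the local isomorphism class
while keeping the unitary group (`unitaryGroup_smul`). -/
theorem det_smul_three (a : K) (hρ : ρ K a = a) (H : Matrix (Fin 3) (Fin 3) K) :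
    (a • H).det = (a * (a * ρ K a)) * H.det := by
  rw [Matrix.det_smul, Fintype.card_fin, hρ]
  ring

end Scaling

/-! ## C. The reciprocity bookkeeping of Lemmas B1.2.4–B1.2.5 (abstract model) -/

section Reciprocity

/-- Local quadratic characters χ_v : G_v →* ℤˣ, one per place v (the Hilbert symbols (·, θ)_v of
O'Meara §63; their kernels are the local norms, O'Meara p0180 ll. 19–22). -/
structure LocalSymbols (ι : Type*) (G : ι → Type*) [∀ v, CommGroup (G v)] where
  /-- the local character at v -/
  χ : ∀ v, G v →* ℤˣ

namespace LocalSymbols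

variable {ι : Type*} {G : ι → Type*} [∀ v, CommGroup (G v)] (S : LocalSymbols ι G)

/-- The global symbol φ(d) = ∏_v χ_v(d_v) of an idèle d (O'Meara 71:19, proof); a finite product —
`finprod` is 1 when the support is infinite, so statements carry a finite-support hypothesis. -/
noncomputable def symbolProd (d : ∀ v, G v) : ℤˣ := ∏ᶠ v, S.χ v (d v)

/-- The norm idèles: everywhere a local norm, i.e. in every kernel (O'Meara's N_{E/F} J_E). -/
def normSubgroup : Subgroup (∀ v, G v) := Subgroup.pi Set.univ (fun v => (S.χ v).ker)

/-- Multiplying by a norm idèle does not change any local symbol. -/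
theorem χ_mul_of_mem_norm (d x : ∀ v, G v) (hx : x ∈ S.normSubgroup) (v : ι) :
    S.χ v ((d * x) v) = S.χ v (d v) := by
  have hv : S.χ v (x v) = 1 :=
    MonoidHom.mem_ker.mp ((Subgroup.mem_pi Set.univ).mp hx v (Set.mem_univ v))
  rw [Pi.mul_apply, map_mul, hv, mul_one]

/-- The global symbol is insensitive to norm idèles. -/
theorem symbolProd_mul_of_mem_norm (d x : ∀ v, G v) (hx : x ∈ S.normSubgroup) :
    S.symbolProd (d * x) = S.symbolProd d :=
  finprod_congr (fun v => S.χ_mul_of_mem_norm d x hx v)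

/-- The global symbol is multiplicative on idèles of finite symbol support. -/
theorem symbolProd_mul (d e : ∀ v, G v) (hd : Function.HasFiniteMulSupport fun v => S.χ v (d v))
    (he : Function.HasFiniteMulSupport fun v => S.χ v (e v)) :
    S.symbolProd (d * e) = S.symbolProd d * S.symbolProd e := by
  unfold symbolProd
  rw [← finprod_mul_distrib hd he]
  exact finprod_congr (fun v => by rw [Pi.mul_apply, map_mul])

/-- Lemma B1.2.4 in the model: if the product formula holds on the principal idèles P (O'Meara
71:18), an idèle of global symbol −1 is not in P · N — it is «incoherent» in the sense of Liu's
Def. C.3 (determinant ∉ F^× N(𝔸_E^×)). -/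
theorem not_mem_sup_of_symbolProd_eq_neg_one (P : Subgroup (∀ v, G v))
    (hrec : ∀ f ∈ P, S.symbolProd f = 1) (d : ∀ v, G v) (hd : S.symbolProd d = -1) :
    d ∉ P ⊔ S.normSubgroup := by
  intro hmem
  obtain ⟨f, hf, x, hx, hfx⟩ := Subgroup.mem_sup.mp hmem
  have : S.symbolProd d = 1 := by
    rw [← hfx, S.symbolProd_mul_of_mem_norm f x hx]
    exact hrec f hf
  rw [hd] at this
  exact absurd this (by decide)

/-- The global symbol of the idèle with one component a at v₀ and 1 elsewhere is χ_{v₀}(a). -/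
theorem symbolProd_mulSingle [DecidableEq ι] (v₀ : ι) (a : G v₀) :
    S.symbolProd (Pi.mulSingle v₀ a) = S.χ v₀ a := by
  unfold symbolProd
  rw [finprod_eq_single (fun v => S.χ v (Pi.mulSingle v₀ a v)) v₀
    (fun v hv => by rw [Pi.mulSingle_eq_of_ne hv, map_one])]
  rw [Pi.mulSingle_eq_same]

/-- The explicit incoherent datum of Lemma B1.2.4: one non-norm component a₀ at one place v₀
(χ_{v₀}(a₀) = −1), 1 elsewhere — not in P · N. -/
theorem mulSingle_not_mem_sup [DecidableEq ι] (P : Subgroup (∀ v, G v))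
    (hrec : ∀ f ∈ P, S.symbolProd f = 1) (v₀ : ι) (a₀ : G v₀) (ha₀ : S.χ v₀ a₀ = -1) :
    Pi.mulSingle v₀ a₀ ∉ P ⊔ S.normSubgroup :=
  S.not_mem_sup_of_symbolProd_eq_neg_one P hrec _ (by rw [S.symbolProd_mulSingle v₀ a₀, ha₀])

/-- Lemma B1.2.5 in the model (both directions): with the product formula on P (O'Meara 71:18),
(P · N) of index 2 (O'Meara 65:21) and one idèle j of global symbol −1 (the idèle that is −1 at one
real place), an idèle d of finite symbol support is outside P · N iff its global symbol is −1:
Liu's Def. C.3 ⟺ Gross §4's «odd number of places where the determinant is not a norm». -/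
theorem symbolProd_eq_neg_one_iff_not_mem (P : Subgroup (∀ v, G v))
    (hrec : ∀ f ∈ P, S.symbolProd f = 1)
    (hfin : ∀ f ∈ P, Function.HasFiniteMulSupport fun v => S.χ v (f v))
    (hidx : (P ⊔ S.normSubgroup).index = 2) (j : ∀ v, G v) (hj : S.symbolProd j = -1)
    (hjfin : Function.HasFiniteMulSupport fun v => S.χ v (j v)) (d : ∀ v, G v) :
    S.symbolProd d = -1 ↔ d ∉ P ⊔ S.normSubgroup := by
  refine ⟨S.not_mem_sup_of_symbolProd_eq_neg_one P hrec d, fun hd => ?_⟩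
  obtain ⟨a, ha⟩ := Subgroup.index_eq_two_iff.mp hidx
  have hjn : j ∉ P ⊔ S.normSubgroup := S.not_mem_sup_of_symbolProd_eq_neg_one P hrec j hj
  have hja : j * a ∈ P ⊔ S.normSubgroup := by
    rcases ha j with ⟨h1, _⟩ | ⟨h2, _⟩
    · exact h1
    · exact absurd h2 hjn
  have hda : d * a ∈ P ⊔ S.normSubgroup := by
    rcases ha d with ⟨h1, _⟩ | ⟨h2, _⟩
    · exact h1
    · exact absurd h2 hd
  have hdj : d * j⁻¹ ∈ P ⊔ S.normSubgroup := by
    have := Subgroup.mul_mem _ hda (Subgroup.inv_mem _ hja)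
    rwa [show d * a * (j * a)⁻¹ = d * j⁻¹ by group] at this
  obtain ⟨f, hf, x, hx, hfx⟩ := Subgroup.mem_sup.mp hdj
  have hd' : d = (f * x) * j := by rw [hfx]; group
  have hfxfin : Function.HasFiniteMulSupport fun v => S.χ v ((f * x) v) := by
    have : (fun v => S.χ v ((f * x) v)) = fun v => S.χ v (f v) :=
      funext (fun v => S.χ_mul_of_mem_norm f x hx v)
    rw [this]; exact hfin f hf
  rw [hd', S.symbolProd_mul _ _ hfxfin hjfin, S.symbolProd_mul_of_mem_norm f x hx, hrec f hf, hj,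
    one_mul]

/-- Rank 3 (n odd): the local symbol of a³·d is that of a·d — squares are norms (χ_v(a²) = 1), so
scaling a rank-3 form by a non-norm switches the local class (prose B1.3). -/
theorem χ_pow_three_mul (v : ι) (a d : G v) : S.χ v (a ^ 3 * d) = S.χ v a * S.χ v d := by
  rw [map_mul, map_pow]
  have h : (S.χ v a) ^ 3 = S.χ v a := by
    rcases Int.units_eq_one_or (S.χ v a) with h | h <;> rw [h] <;> decide
  rw [h]

end LocalSymbols

end Reciprocity

end Summit.Ventures.HodgeRepro2.T4GroupData
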